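import Summits.NavierStokesRegularity.NavierStokesRegularity.Theorems.ExtremiserTransienceNearExtremalTransienceExtremiserLiouvilleConstantSpeedDiscreteProductRuleShift
import Summits.NavierStokesRegularity.NavierStokesRegularity.Theorems.ExtremiserTransienceNearExtremalTransienceExtremiserLiouvilleConstantSpeedGlobalVariation
import HarnessLib

/-!
# Crux `ExtremiserTransience.NearExtremalTransience` (stmt-NavierStokesRegularity-21883), line `extremiser_liouville`,
# stub K1b — THE `D³V`-LOOKING PART OF `c₁(−h⁻¹φ̂_h)` IS BOUNDED BY `½∫(D₋ₕg)|Dω|²_F` (record §13, R3′ core)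

`--supports stmt-NavierStokesRegularity-21883` (helper).  Author: prover seat `ns-el-k1b` (g8).
In the pointwise decomposition of the palinstrophy integrand along the discrete slide (…SlidePalinstrophyPointwise) the only
term that would involve `D³V` in the limit is `−Σᵢ g(x₂−h)⟪∂ᵢω, D₋ₕ∂ᵢω⟫` (`ω = curl V`, `D₋ₕF = h⁻¹(F − F(·−he₂))`).  Summing
the shifted discrete product rule (p728345) over the standard basis:
* `sum_neg_integral_shiftedWeight_inner_backwardQuotient_le` :
  **`Σᵢ −∫ g(x₂−h)⟪Dω(x)bᵢ, h⁻¹(Dω(x)bᵢ − Dω(x−he₂)bᵢ)⟫ ≤ ½∫ h⁻¹(g(x₂) − g(x₂−h))·|Dω(x)|²_F`**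
  for `V ∈ C^∞` with `D²V ∈ L²`, `g ≥ 0` continuous bounded, `h > 0` (`bᵢ = EuclideanSpace.basisFun`, `|·|²_F = frobeniusNormSq`).

WHAT THIS IS NOT: K1b is NOT proved; nothing here proves NS regularity. [folklore]
-/

noncomputable section

open Set Filter Topology MeasureTheory Metric Function InnerProductSpace
open scoped ENNReal NNReal Topology InnerProductSpace RealInnerProductSpace ContDiff
open Literature.Analysis.FluidPDE Literature.Analysis

namespace Summit.NavierStokesRegularity.NavierStokesRegularity.Theorems

-- the problem directory repeats the summit name (`NavierStokesRegularity/NavierStokesRegularity`)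
set_option linter.dupNamespace false

namespace ExtremiserLiouville

open DepletionLadder.KStar

variable {V : EuclideanSpace ℝ (Fin 3) → EuclideanSpace ℝ (Fin 3)} {g : ℝ → ℝ}

/-- **The bad term of the discrete palinstrophy variation is bounded by `½∫(D₋ₕg)|Dω|²_F`.** [folklore] -/
theorem sum_neg_integral_shiftedWeight_inner_backwardQuotient_le (hV : ContDiff ℝ ∞ V)
    (h2 : ∫⁻ x, ‖iteratedFDeriv ℝ 2 V x‖ₑ ^ 2 < ⊤) (hg : Continuous g) {K : ℝ} (hgK : ∀ s, |g s| ≤ K)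
    (hg0 : ∀ s, 0 ≤ g s) {h : ℝ} (hh : 0 < h) :
    ∑ i : Fin 3, -(∫ x, g (x 2 - h) * ⟪fderiv ℝ (curl V) x (EuclideanSpace.basisFun (Fin 3) ℝ i),
        h⁻¹ • (fderiv ℝ (curl V) x (EuclideanSpace.basisFun (Fin 3) ℝ i) -
          fderiv ℝ (curl V) (x - h • EuclideanSpace.single (2 : Fin 3) (1 : ℝ)) (EuclideanSpace.basisFun (Fin 3) ℝ i))⟫) ≤
      (1 / 2) * ∫ x, (h⁻¹ * (g (x 2) - g (x 2 - h))) * frobeniusNormSq (fderiv ℝ (curl V) x) := by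
  set b := EuclideanSpace.basisFun (Fin 3) ℝ with hb
  have hV3 : ContDiff ℝ 3 V := hV.of_le (WithTop.coe_le_coe.mpr le_top)
  have hω1 : ContDiff ℝ 1 (curl V) := contDiff_curl (n := 1) (hV.of_le (WithTop.coe_le_coe.mpr le_top))
  have cDω : Continuous (fderiv ℝ (curl V)) := hω1.continuous_fderiv one_ne_zero
  have iF : Integrable (fun x => frobeniusNormSq (fderiv ℝ (curl V) x)) (volume : Measure (EuclideanSpace ℝ (Fin 3))) :=
    (integrable_frobeniusNormSq_fderiv_curl hV3 h2).1
  -- each component is square integrable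
  have hcomp : ∀ i : Fin 3, Integrable (fun x => ‖fderiv ℝ (curl V) x (b i)‖ ^ 2) (volume : Measure (EuclideanSpace ℝ (Fin 3))) := by
    intro i
    refine iF.mono' ((cDω.clm_apply continuous_const).norm.pow 2).aestronglyMeasurable (Eventually.of_forall fun x => ?_)
    rw [Real.norm_eq_abs, abs_of_nonneg (sq_nonneg _), frobeniusNormSq_eq_sum b]
    exact Finset.single_le_sum (f := fun j => ‖fderiv ℝ (curl V) x (b j)‖ ^ 2) (fun j _ => sq_nonneg _) (Finset.mem_univ i)
  -- the shifted discrete product rule, component by component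
  have hstep : ∀ i : Fin 3, -(∫ x, g (x 2 - h) * ⟪fderiv ℝ (curl V) x (b i),
      h⁻¹ • (fderiv ℝ (curl V) x (b i) - fderiv ℝ (curl V) (x - h • EuclideanSpace.single (2 : Fin 3) (1 : ℝ)) (b i))⟫) ≤
      (1 / 2) * ∫ x, (h⁻¹ * (g (x 2) - g (x 2 - h))) * ‖fderiv ℝ (curl V) x (b i)‖ ^ 2 := fun i =>
    neg_integral_shiftedWeight_inner_backwardQuotient_le (F := fun x => fderiv ℝ (curl V) x (b i))
      (cDω.clm_apply continuous_const) (hcomp i) hg hgK hg0 hh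
  refine (Finset.sum_le_sum fun i _ => hstep i).trans (le_of_eq ?_)
  -- `Σᵢ ½∫ w‖∂ᵢω‖² = ½∫ w |Dω|²_F`
  have hK1 : ∀ s, |h⁻¹ * (g s - g (s - h))| ≤ h⁻¹ * (K + K) := by
    intro s
    rw [abs_mul, abs_of_pos (inv_pos.2 hh)]
    exact mul_le_mul_of_nonneg_left ((abs_sub _ _).trans (add_le_add (hgK _) (hgK _))) (inv_nonneg.2 hh.le)
  have cw : Continuous fun x : EuclideanSpace ℝ (Fin 3) => h⁻¹ * (g (x 2) - g (x 2 - h)) :=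
    continuous_const.mul ((hg.comp (PiLp.continuous_apply 2 _ (2 : Fin 3))).sub
      (hg.comp ((PiLp.continuous_apply 2 _ (2 : Fin 3)).sub continuous_const)))
  have iw : ∀ i : Fin 3, Integrable (fun x => (h⁻¹ * (g (x 2) - g (x 2 - h))) * ‖fderiv ℝ (curl V) x (b i)‖ ^ 2)
      (volume : Measure (EuclideanSpace ℝ (Fin 3))) := by
    intro i
    refine ((hcomp i).const_mul (h⁻¹ * (K + K))).mono' (cw.aestronglyMeasurable.mul (hcomp i).1)
      (Eventually.of_forall fun x => ?_)
    rw [Real.norm_eq_abs, abs_mul, abs_of_nonneg (sq_nonneg ‖fderiv ℝ (curl V) x (b i)‖)]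
    exact mul_le_mul_of_nonneg_right (hK1 _) (sq_nonneg _)
  rw [← Finset.mul_sum, ← integral_finsetSum _ fun i _ => iw i]
  congr 1
  refine integral_congr_ae (Eventually.of_forall fun x => ?_)
  show ∑ i : Fin 3, (h⁻¹ * (g (x 2) - g (x 2 - h))) * ‖fderiv ℝ (curl V) x (b i)‖ ^ 2 =
    (h⁻¹ * (g (x 2) - g (x 2 - h))) * frobeniusNormSq (fderiv ℝ (curl V) x)
  rw [← Finset.mul_sum, frobeniusNormSq_eq_sum b]

end ExtremiserLiouville

end Summit.NavierStokesRegularity.NavierStokesRegularity.Theorems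

end
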